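import Mathlib
import Literature.AlgebraicGeometry.Markman2025.SecantQuotientCarrier
import HarnessLib

/-!
# FourTranslatesMeet

Topic `Literature/AlgebraicGeometry/Motives`. Named literature fact(s) relocated by the gate from `Summits/HodgeConjecture/HodgeConjecture/Theorems/SheafSeedGaussSq/Negative/SecantTranslatesGeneralPosition.lean`
(accept-time relocation of `[cite]`d propositions written inline in a Summits proposal; human ruling 2026-08-15).
Sources: Hartshorne1977, MumfordAV1970.

* `Literature.AlgebraicGeometry.Motives.FourTranslatesMeet`
-/

namespace Literature.AlgebraicGeometry.Motives

open CategoryTheory AlgebraicGeometry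
open Literature.AlgebraicGeometry Literature.AlgebraicGeometry.Motives Literature.AlgebraicGeometry.Motives.AbelianVariety
open Literature.AlgebraicGeometry.Markman2025

/-- **`H` — FOUR TRANSLATES OF `Θ` MEET ON AN ABELIAN FOURFOLD.** For an abelian variety `A` over `ℂ` of dimension `4`
and an effective ample Cartier divisor `Θ` on `A`, any four translates `τ_{s}(Supp Θ)` (`Supp Θ = A ∖ A_{1}`, the zero
locus of the canonical section `1 ∈ Γ(𝒪(Θ))`) have a common point. IN PRINT, NOT PROVED HERE (the tree has neither
intersection numbers nor the projective dimension theorem): each `τ_{-s}^*Θ` is again effective and ample (pull-back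
along an automorphism), so for `m ≫ 0` the complete linear system `|m·τ_{-s}^*Θ|` embeds the projective variety `A`
(Hartshorne II Thm. 7.6; Mumford §6 Application 1) with `τ_s(Supp Θ) = Supp(τ_{-s}^*(mΘ)) = A ∩ H_s` a HYPERPLANE SECTION;
`Supp Θ ≠ ∅` (an ample line bundle on a proper variety of positive dimension is not trivial); and Hartshorne I Thm. 7.2
(projective dimension theorem: for a variety `Y ⊆ ℙᴺ` of dimension `r ≥ 1` and a hyperplane `H`, `Y ∩ H ≠ ∅` and every
component has dimension `≥ r − 1`) applied four times, re-embedding at each step, takes `A` (dimension `4`) to a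
non-empty `τ_{s₁}Θ ∩ τ_{s₂}Θ ∩ τ_{s₃}Θ ∩ τ_{s₄}Θ` with components of dimension `≥ 0`. (Numerically:
`(τ_{s₁}Θ · τ_{s₂}Θ · τ_{s₃}Θ · τ_{s₄}Θ) = (Θ⁴) = 4!·χ(Θ) > 0`, Riemann–Roch on abelian varieties.) Stated as a precise `Prop`
so that the negative lemmas below are kernel-checked implications `H → ¬…`; FIVE translates can be disjoint, so `4 = dim A`
is sharp. [cite: Hartshorne1977, I Thm. 7.2 (Projective Dimension Theorem, p. 48) and II Thm. 7.6 (ample: a multiple is very ample)]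
[cite: MumfordAV1970, §6 Application 1 (p. 62: abelian varieties are projective) and §16 (Riemann–Roch: χ(L)² = deg φ_L, (Lᵍ) = g!·χ(L))]
[topic AlgebraicGeometry/Motives] -/
def FourTranslatesMeet : Prop :=
  ∀ (A : AbelianVariety ℂ) (Θ : CartierDivisor A.X.left), A.dim = 4 → Θ.IsEffective → Θ.IsAmple →
    ∀ s₁ s₂ s₃ s₄ : A.Points ℂ,
      (thetaTranslate A Θ s₁ ∩ thetaTranslate A Θ s₂ ∩ thetaTranslate A Θ s₃ ∩ thetaTranslate A Θ s₄).Nonempty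

/-! ## §3 Modulo `H`: the general-position field is false in dimension 4; the datum's fields are contradictory -/

end Literature.AlgebraicGeometry.Motives
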